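/-
Copyright (c) 2026 the pub-hodgecm-mathlib formalisation cell (harness21).  Prover seat hodgecm-mathlib-LH5-p02 (g11): E1 row 47c-4χ(a) «EIGEN-RESTRICTION OF A GRADED SHIFT MODULE +
ISOTYPIC SNAKE» (pre-dealt by the 47d consumer F0P3a-p04 (g31), interim E1 reader F0P3a-p09 (g15); census row 47 «NON-ELLIPTIC VANISHING OF `f_EP^{V,e}`» F0P3-p02 (g26) §2 (A3) «isotype by
isotype under the compact `T_c`»), 2026-09-03.
-/
import Literature.LinearAlgebra.ShiftMinusIdentity     -- ★ 47c FILE 2a (F0P3-p02): `injective_sub_id_of_shift`, `finrank_quotient_range_sub_id_eq`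
import Literature.LinearAlgebra.SnakeCokernelRank       -- ★ 47a′ (this seat): `finrank_quotient_range_eq_of_exact`
import Mathlib.LinearAlgebra.FiniteDimensional.Lemmas
import HarnessLib

/-!
# Simultaneous eigenspaces of a commuting family: restriction of a graded shift module and of a short exact sequence (the isotypic snake)

Topic `LinearAlgebra`; namespace `LinearMap` (deliberate dot-notation extension); THEOREMS ONLY (no definition, instance, notation or named fact); Mathlib + ★ `ShiftMinusIdentity` + ★
`SnakeCokernelRank`.  Cell `pub/hodgecm-mathlib` (D-0151), crux H413 = `stmt-HodgeConjecture-24833`, lane `--supports`; E1 census row 47 (F0P3-p02 (g26)) §2 (A3): the Euler identity of the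
Jacquet module of the Schneider–Stuhler resolution ISOTYPE BY ISOTYPE under the compact torus `T_c` (47d's input, F0P3a-p04 (g31) 2026-09-03T02:44Z «χ′-GAP»).  This file is the GENERIC
half (47c-4χ(a)); the instantiation in the block-permutation letters of ★ 47c FILES 1–4 is 47c-4χ(b).  Count-neutral generic base layer; HC_CM is proved only modulo the 7 printed citations
(2 remaining named inputs: hLiu418 = `stmt-HodgeConjecture-24832`, h413 = `stmt-HodgeConjecture-24833`) until rung 0 closes.

THE SIMULTANEOUS EIGENSPACE is carried HYPOTHESIS-STYLE: a family of endomorphisms `T : ι → End M`, scalars `χ : ι → k`, and a submodule `E` with `hE : x ∈ E ↔ ∀ i, T i x = χ i • x`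
(at the datum: `ι = T_c`, `T c = r(c)` on a Jacquet module, `χ = χ′`; equivalently the invariants of the twist by `χ′⁻¹`).
* §1 `E` is stable under every `φ` commuting with the `T i` (`apply_mem_eigen_of_comp_eq_comp`); pull-back of `E` along an equivariant injection is the eigenspace upstairs.
* §2 COMPONENTS OF AN EIGENVECTOR ARE EIGENVECTORS: for an INDEPENDENT family `W n` of `T`-stable submodules, `E ⊓ ⨆ W = ⨆ (W n ⊓ E)` (`exists_finsupp_mem_inf_eigen_of_mem_iSup`,
  `inf_iSup_eq_iSup_inf_eigen`), and for an internal direct sum `M = ⊕ W n` the traces `(W n).comap E.subtype` form an internal direct sum of `↥E` (`isInternal_comap_subtype_eigen`).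
* §3 THE SHIFT: if `φ` commutes with the `T i`, is injective and `φ(W n) = W (n+1)`, the same holds inside `↥E`; hence ★ 2a inside `E`:
  **`finrank (↥E ⧸ range (φ|_E − 1)) = finrank ↥(W 0 ⊓ E)`** (`finrank_quotient_range_restrict_sub_id_eq`) and `φ|_E − 1` is injective.
* §4 ADDITIVITY: for a `Finset`-indexed `SupIndep` family of `T`-stable finite-dimensional `P r`, `finrank ↥((⨆_{r ∈ S} P r) ⊓ E) = Σ_{r ∈ S} finrank ↥(P r ⊓ E)`.
* §5 THE ISOTYPIC SNAKE: for `0 → A → B → C → 0` exact with commuting endomorphisms `a b c` as in ★ 47a′, commuting `T`-families `TA TB TC` intertwined by `f g` and commuting with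
  `a b c`, eigen-submodules `EA EB EC`, and ONE analytic input «`g` maps `EB` ONTO `EC`» (at the datum: exactness of `T_c`-isotypic parts for compact `T_c` acting smoothly, ★ 41e),
  **`finrank (↥EA ⧸ range a|_EA) = finrank (↥EB ⧸ range b|_EB)`** when `C` is finite-dimensional (`finrank_quotient_range_restrict_eq_of_exact`).

## References
* [Brown1982] K. S. Brown, *Cohomology of Groups*, GTM 87 (1982), III §5–§6.
* [BernsteinZelevinsky1976] I. N. Bernstein, A. V. Zelevinsky, *Representations of the group `GL(n,F)`*, Russian Math. Surveys 31 (1976), §2.3 (Jacquet modules; isotypic components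
  under a compact torus).
* [Casselman1995] W. Casselman, *Introduction to the theory of admissible representations of `p`-adic reductive groups* (1995 notes), §6.3.
-/

set_option autoImplicit false

namespace LinearMap

open Function Module

section Eigen

variable {k M : Type*} [Field k] [AddCommGroup M] [Module k M] {ι : Type*} {T : ι → M →ₗ[k] M} {χ : ι → k} {E : Submodule k M}

/-! ## §1 Stability of the simultaneous eigenspace -/

/-- An endomorphism commuting with every `T i` maps the simultaneous eigenspace `E = {x | ∀ i, T i x = χ i • x}` into itself. [cite: Brown1982, III §5] -/
theorem apply_mem_eigen_of_comp_eq_comp (hE : ∀ x, x ∈ E ↔ ∀ i, T i x = χ i • x) {φ : M →ₗ[k] M} (hφ : ∀ i, φ ∘ₗ T i = T i ∘ₗ φ) {x : M} (hx : x ∈ E) :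
    φ x ∈ E := by
  rw [hE] at hx ⊢
  intro i
  rw [← LinearMap.comp_apply, ← hφ i, LinearMap.comp_apply, hx i, map_smul]

/-- Pull-back of an eigenvector along an equivariant INJECTION is an eigenvector: `f x ∈ E_B ⇒ x ∈ E_A` for `f ∘ TA i = TB i ∘ f`, `f` injective.
[cite: BernsteinZelevinsky1976, §2.3] -/
theorem mem_eigen_of_apply_mem_eigen {N : Type*} [AddCommGroup N] [Module k N] {TN : ι → N →ₗ[k] N} {EN : Submodule k N}
    (hE : ∀ x, x ∈ E ↔ ∀ i, T i x = χ i • x) (hEN : ∀ y, y ∈ EN ↔ ∀ i, TN i y = χ i • y)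
    {f : M →ₗ[k] N} (hf : Injective f) (hfT : ∀ i, f ∘ₗ T i = TN i ∘ₗ f) {x : M} (hx : f x ∈ EN) : x ∈ E := by
  rw [hE]
  rw [hEN] at hx
  intro i
  apply hf
  rw [← LinearMap.comp_apply, hfT i, LinearMap.comp_apply, hx i, map_smul]

/-- Push-forward along an equivariant map: `x ∈ E_A ⇒ f x ∈ E_B`. [cite: BernsteinZelevinsky1976, §2.3] -/
theorem apply_mem_eigen_of_mem_eigen {N : Type*} [AddCommGroup N] [Module k N] {TN : ι → N →ₗ[k] N} {EN : Submodule k N}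
    (hE : ∀ x, x ∈ E ↔ ∀ i, T i x = χ i • x) (hEN : ∀ y, y ∈ EN ↔ ∀ i, TN i y = χ i • y)
    {f : M →ₗ[k] N} (hfT : ∀ i, f ∘ₗ T i = TN i ∘ₗ f) {x : M} (hx : x ∈ E) : f x ∈ EN := by
  rw [hEN]
  rw [hE] at hx
  intro i
  rw [← LinearMap.comp_apply, ← hfT i, LinearMap.comp_apply, hx i, map_smul]

/-! ## §2 Components of an eigenvector are eigenvectors -/

/-- **COMPONENTS OF AN EIGENVECTOR ARE EIGENVECTORS**: for an INDEPENDENT family of `T`-stable submodules `W n`, an eigenvector in `⨆ W` is a finite sum of eigenvectors `y n ∈ W n`.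
(Apply `T i − χ i` to a decomposition `x = Σ y n`: the `n`-th defect lies in `W n ⊓ ⨆_{m ≠ n} W m = 0`.) [cite: Brown1982, III §5] -/
theorem exists_finsupp_mem_inf_eigen_of_mem_iSup (hE : ∀ x, x ∈ E ↔ ∀ i, T i x = χ i • x) {σ : Type*} {W : σ → Submodule k M} (hind : iSupIndep W)
    (hTW : ∀ i n, ∀ x ∈ W n, T i x ∈ W n) {x : M} (hxE : x ∈ E) (hxW : x ∈ ⨆ n, W n) :
    ∃ y : σ →₀ M, (∀ n, y n ∈ W n ⊓ E) ∧ (y.sum fun _ m => m) = x := by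
  classical
  obtain ⟨y, hyW, hyx⟩ := (Submodule.mem_iSup_iff_exists_finsupp W x).1 hxW
  refine ⟨y, fun n => Submodule.mem_inf.2 ⟨hyW n, ?_⟩, hyx⟩
  rw [hE]
  intro i
  -- the defect `u m := T i (y m) − χ i • y m`
  have hsum0 : (y.sum fun m c => T i c - χ i • c) = 0 := by
    have h1 : (y.sum fun m c => T i c) = T i x := by rw [← hyx, map_finsuppSum]
    have h2 : (y.sum fun m c => χ i • c) = χ i • x := by rw [← hyx, Finsupp.smul_sum]
    have : (y.sum fun m c => T i c - χ i • c) = (y.sum fun m c => T i c) - y.sum fun m c => χ i • c := by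
      simp only [Finsupp.sum, Finset.sum_sub_distrib]
    rw [this, h1, h2, ((hE x).1 hxE) i, sub_self]
  -- the `n`-th defect is in `W n` and in `⨆_{m ≠ n} W m`
  have hun : T i (y n) - χ i • y n ∈ W n := Submodule.sub_mem _ (hTW i n _ (hyW n)) (Submodule.smul_mem _ _ (hyW n))
  have hrest : -(T i (y n) - χ i • y n) = (y.sum fun m c => T i c - χ i • c) - (T i (y n) - χ i • y n) := by rw [hsum0, zero_sub]
  have hmem : -(T i (y n) - χ i • y n) ∈ ⨆ (m) (_ : m ≠ n), W m := by
    rw [hrest, Finsupp.sum]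
    by_cases hn : n ∈ y.support
    · rw [← Finset.sum_erase_eq_sub hn]
      refine Submodule.sum_mem _ fun m hm => ?_
      have hmn : m ≠ n := Finset.ne_of_mem_erase hm
      exact Submodule.mem_iSup_of_mem m (Submodule.mem_iSup_of_mem hmn
        (Submodule.sub_mem _ (hTW i m _ (hyW m)) (Submodule.smul_mem _ _ (hyW m))))
    · have hy0 : y n = 0 := Finsupp.notMem_support_iff.1 hn
      rw [hy0, map_zero, smul_zero, sub_zero, sub_zero]
      refine Submodule.sum_mem _ fun m hm => ?_
      have hmn : m ≠ n := fun h => hn (h ▸ hm)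
      exact Submodule.mem_iSup_of_mem m (Submodule.mem_iSup_of_mem hmn
        (Submodule.sub_mem _ (hTW i m _ (hyW m)) (Submodule.smul_mem _ _ (hyW m))))
  have hdis := (hind n).le_bot ⟨hun, (Submodule.neg_mem_iff _).1 hmem⟩
  rw [Submodule.mem_bot, sub_eq_zero] at hdis
  exact hdis

/-- `E ⊓ ⨆ W n = ⨆ (W n ⊓ E)` for an independent family of `T`-stable `W n`. [cite: Brown1982, III §5] -/
theorem inf_iSup_eq_iSup_inf_eigen (hE : ∀ x, x ∈ E ↔ ∀ i, T i x = χ i • x) {σ : Type*} {W : σ → Submodule k M} (hind : iSupIndep W)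
    (hTW : ∀ i n, ∀ x ∈ W n, T i x ∈ W n) : E ⊓ (⨆ n, W n) = ⨆ n, (W n ⊓ E) := by
  refine le_antisymm ?_ (iSup_le fun n => le_inf (inf_le_right) ((inf_le_left).trans (le_iSup W n)))
  rintro x ⟨hxE, hxW⟩
  obtain ⟨y, hy, rfl⟩ := exists_finsupp_mem_inf_eigen_of_mem_iSup hE hind hTW hxE hxW
  exact Submodule.sum_mem _ fun n _ => Submodule.mem_iSup_of_mem n (hy n)

/-- **THE EIGENSPACE OF AN INTERNAL DIRECT SUM OF `T`-STABLE PIECES IS THE INTERNAL DIRECT SUM OF ITS TRACES**: `↥E = ⊕_n (W n).comap E.subtype`. [cite: Brown1982, III §5] -/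
theorem isInternal_comap_subtype_eigen (hE : ∀ x, x ∈ E ↔ ∀ i, T i x = χ i • x) {σ : Type*} [DecidableEq σ] {W : σ → Submodule k M} (hW : DirectSum.IsInternal W)
    (hTW : ∀ i n, ∀ x ∈ W n, T i x ∈ W n) : DirectSum.IsInternal fun n => (W n).comap E.subtype := by
  rw [DirectSum.isInternal_submodule_iff_iSupIndep_and_iSup_eq_top]
  constructor
  · -- independence pulls back along the injective `E.subtype`
    intro n
    rw [disjoint_iff, eq_bot_iff]
    rintro z ⟨hz1, hz2⟩
    have h1 : (z : M) ∈ W n := hz1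
    have h2 : (z : M) ∈ ⨆ (m) (_ : m ≠ n), W m := by
      have hz2' := Submodule.mem_map_of_mem (f := E.subtype) hz2
      have hle : (⨆ (m) (_ : m ≠ n), (W m).comap E.subtype).map E.subtype ≤ ⨆ (m) (_ : m ≠ n), W m := by
        rw [Submodule.map_iSup]
        refine iSup_mono fun m => ?_
        rw [Submodule.map_iSup]
        exact iSup_mono fun _ => Submodule.map_comap_le _ _
      exact hle hz2'
    have := (hW.submodule_iSupIndep n).le_bot ⟨h1, h2⟩
    rw [Submodule.mem_bot] at this ⊢
    exact Subtype.ext this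
  · rw [eq_top_iff]
    rintro ⟨x, hxE⟩ -
    have hxW : x ∈ ⨆ n, W n := by rw [hW.submodule_iSup_eq_top]; trivial
    obtain ⟨y, hy, hyx⟩ := exists_finsupp_mem_inf_eigen_of_mem_iSup hE hW.submodule_iSupIndep hTW hxE hxW
    have hxy : (⟨x, hxE⟩ : E) = ∑ n ∈ y.support, (⟨y n, (Submodule.mem_inf.1 (hy n)).2⟩ : E) := by
      apply Subtype.ext
      rw [Submodule.coe_sum]
      exact hyx.symm
    have hmem : (∑ n ∈ y.support, (⟨y n, (Submodule.mem_inf.1 (hy n)).2⟩ : E)) ∈ ⨆ n, (W n).comap E.subtype :=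
      Submodule.sum_mem _ fun n _ => Submodule.mem_iSup_of_mem n (Submodule.mem_inf.1 (hy n)).1
    rwa [← hxy] at hmem

/-! ## §3 The shift inside the eigenspace; ★ 2a restricted -/

/-- **THE SHIFT RESTRICTS**: `φ` commuting with the `T i`, injective, with `φ(W n) = W (n+1)` ⇒ `φ|_E ((W n).comap E.subtype) = (W (n+1)).comap E.subtype` (the inclusion `⊇` uses the
injectivity of `φ`: the preimage of an eigenvector is an eigenvector). [cite: Brown1982, III §5] [cite: BernsteinZelevinsky1976, §2.3] -/
theorem map_restrict_comap_subtype_eigen_eq (hE : ∀ x, x ∈ E ↔ ∀ i, T i x = χ i • x) {φ : M →ₗ[k] M} (hφT : ∀ i, φ ∘ₗ T i = T i ∘ₗ φ) (hinj : Injective φ)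
    {σ : Type*} {W : σ → Submodule k M} {s : σ → σ} (hφW : ∀ n, (W n).map φ = W (s n))
    (hφE : ∀ x ∈ E, φ x ∈ E) (n : σ) :
    ((W n).comap E.subtype).map (φ.restrict hφE) = (W (s n)).comap E.subtype := by
  ext ⟨y, hyE⟩
  simp only [Submodule.mem_map, Submodule.mem_comap, Submodule.coe_subtype]
  constructor
  · rintro ⟨⟨x, hxE⟩, hxW, hxy⟩
    have hxy' : φ x = y := by
      have := congrArg Subtype.val hxy
      simpa [LinearMap.restrict_apply] using this
    rw [← hxy', ← hφW n]
    exact Submodule.mem_map_of_mem hxW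
  · intro hyW
    rw [← hφW n] at hyW
    obtain ⟨x, hxW, hxy⟩ := hyW
    have hxE : x ∈ E := mem_eigen_of_apply_mem_eigen hE hE hinj hφT (by rw [hxy]; exact hyE)
    exact ⟨⟨x, hxE⟩, hxW, Subtype.ext (by simpa [LinearMap.restrict_apply] using hxy)⟩

/-- **★ 2a INSIDE THE EIGENSPACE**: for an internal `ℤ`-grading `M = ⊕ W n` by `T`-stable pieces, and `φ` commuting with the `T i`, injective, with `φ(W n) = W (n+1)`:
`φ|_E − 1` is injective on `E` and **`finrank (↥E ⧸ range (φ|_E − 1)) = finrank ↥(W 0 ⊓ E)`**. [cite: Brown1982, III §5] [cite: BernsteinZelevinsky1976, §2.3] -/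
theorem finrank_quotient_range_restrict_sub_id_eq (hE : ∀ x, x ∈ E ↔ ∀ i, T i x = χ i • x) {W : ℤ → Submodule k M} (hW : DirectSum.IsInternal W)
    (hTW : ∀ i n, ∀ x ∈ W n, T i x ∈ W n) {φ : M →ₗ[k] M} (hφT : ∀ i, φ ∘ₗ T i = T i ∘ₗ φ) (hinj : Injective φ) (hφW : ∀ n, (W n).map φ = W (n + 1))
    (hφE : ∀ x ∈ E, φ x ∈ E) :
    Injective (φ.restrict hφE - LinearMap.id : ↥E →ₗ[k] ↥E) ∧
      finrank k (↥E ⧸ LinearMap.range (φ.restrict hφE - LinearMap.id : ↥E →ₗ[k] ↥E)) = finrank k ↥(W 0 ⊓ E) := by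
  classical
  have hW' : DirectSum.IsInternal fun n => (W n).comap E.subtype := isInternal_comap_subtype_eigen hE hW hTW
  have hinj' : Injective (φ.restrict hφE) := fun x y hxy => Subtype.ext (hinj (by simpa [LinearMap.restrict_apply] using congrArg Subtype.val hxy))
  have hφW' : ∀ n, ((W n).comap E.subtype).map (φ.restrict hφE) = (W (n + 1)).comap E.subtype :=
    map_restrict_comap_subtype_eigen_eq hE hφT hinj (s := fun n => n + 1) hφW hφE
  refine ⟨injective_sub_id_of_shift hW' hinj' (fun n x hx => by rw [← hφW' n]; exact Submodule.mem_map_of_mem hx), ?_⟩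
  -- `finrank ((W 0).comap E.subtype) = finrank ↥(E ⊓ W 0)` is ★ `Literature.LinearAlgebra.Alternating.finrank_comap_subtype_eq_finrank_inf` (two Mathlib rewrites, inlined)
  rw [finrank_quotient_range_sub_id_eq hW' hinj' hφW', ← Submodule.finrank_map_subtype_eq E ((W 0).comap E.subtype), Submodule.map_comap_subtype, inf_comm]

/-! ## §4 Additivity over an independent finite family of `T`-stable pieces -/

/-- Two-piece case: for DISJOINT `T`-stable `P, Q`, `(P ⊔ Q) ⊓ E = (P ⊓ E) ⊔ (Q ⊓ E)` (the `P`- and `Q`-parts of an eigenvector are eigenvectors). [cite: Brown1982, III §5] -/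
theorem sup_inf_eigen_eq_of_disjoint (hE : ∀ x, x ∈ E ↔ ∀ i, T i x = χ i • x) {P Q : Submodule k M} (hPQ : Disjoint P Q)
    (hTP : ∀ i, ∀ x ∈ P, T i x ∈ P) (hTQ : ∀ i, ∀ x ∈ Q, T i x ∈ Q) : (P ⊔ Q) ⊓ E = (P ⊓ E) ⊔ (Q ⊓ E) := by
  refine le_antisymm ?_ (sup_le (inf_le_inf_right E le_sup_left) (inf_le_inf_right E le_sup_right))
  rintro x ⟨hxPQ, hxE⟩
  obtain ⟨p, hp, q, hq, rfl⟩ := Submodule.mem_sup.1 hxPQ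
  have hpE : p ∈ E := by
    rw [hE]
    intro i
    have hx := ((hE _).1 hxE) i
    rw [map_add, smul_add] at hx
    -- `T i p − χ i • p = −(T i q − χ i • q) ∈ P ⊓ Q = ⊥`
    have h1 : T i p - χ i • p ∈ P := Submodule.sub_mem _ (hTP i p hp) (Submodule.smul_mem _ _ hp)
    have h2 : T i p - χ i • p ∈ Q := by
      have : T i p - χ i • p = -(T i q - χ i • q) := by
        rw [neg_sub, sub_eq_sub_iff_add_eq_add, add_comm (χ i • q), hx]
      rw [this]
      exact Submodule.neg_mem _ (Submodule.sub_mem _ (hTQ i q hq) (Submodule.smul_mem _ _ hq))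
    have := hPQ.le_bot ⟨h1, h2⟩
    rwa [Submodule.mem_bot, sub_eq_zero] at this
  have hqE : q ∈ E := by
    have : q = (p + q) - p := by abel
    rw [this]
    exact Submodule.sub_mem _ hxE hpE
  exact Submodule.add_mem_sup ⟨hp, hpE⟩ ⟨hq, hqE⟩

/-- A finite sup of `T`-stable submodules is `T`-stable. [cite: Brown1982, III §5] -/
theorem apply_mem_finsetSup_of_forall {α : Type*} (P : α → Submodule k M) (hTP : ∀ i r, ∀ x ∈ P r, T i x ∈ P r) (S : Finset α) (i : ι)
    {x : M} (hx : x ∈ S.sup P) : T i x ∈ S.sup P := by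
  classical
  induction S using Finset.induction_on generalizing x with
  | empty =>
    rw [Finset.sup_empty, Submodule.mem_bot] at hx
    rw [hx, map_zero, Finset.sup_empty]
    exact Submodule.zero_mem _
  | insert a s ha ih =>
    rw [Finset.sup_insert] at hx ⊢
    obtain ⟨p, hp, q, hq, rfl⟩ := Submodule.mem_sup.1 hx
    rw [map_add]
    exact Submodule.add_mem_sup (hTP i a p hp) (ih hq)

/-- **ADDITIVITY**: for a `SupIndep` finite family of `T`-stable FINITE-DIMENSIONAL submodules `P r`, `finrank ↥((S.sup P) ⊓ E) = Σ_{r ∈ S} finrank ↥(P r ⊓ E)` (`S.sup P = ⨆_{r ∈ S} P r`,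
Mathlib `Finset.sup_eq_iSup`). [cite: Brown1982, III §5] -/
theorem finrank_finsetSup_inf_eigen_eq_sum (hE : ∀ x, x ∈ E ↔ ∀ i, T i x = χ i • x) {α : Type*} [DecidableEq α] (P : α → Submodule k M)
    (hTP : ∀ i r, ∀ x ∈ P r, T i x ∈ P r) [hfd : ∀ r, FiniteDimensional k (P r)] (S : Finset α) (hind : S.SupIndep P) :
    finrank k ↥((S.sup P) ⊓ E) = ∑ r ∈ S, finrank k ↥(P r ⊓ E) := by
  induction S using Finset.induction_on with
  | empty => simp
  | insert a s ha ih =>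
    have hs : s.SupIndep P := hind.subset (Finset.subset_insert a s)
    have hdis : Disjoint (P a) (s.sup P) := hind (Finset.subset_insert a s) (Finset.mem_insert_self a s) ha
    rw [Finset.sum_insert ha, ← ih hs, Finset.sup_insert,
      sup_inf_eigen_eq_of_disjoint hE hdis (hTP · a) (fun i x hx => apply_mem_finsetSup_of_forall P hTP s i hx)]
    haveI : FiniteDimensional k ↥(s.sup P) := Submodule.finiteDimensional_finset_sup s P
    have hkey := Submodule.finrank_sup_add_finrank_inf_eq (P a ⊓ E) (s.sup P ⊓ E)
    have hbot : (P a ⊓ E) ⊓ (s.sup P ⊓ E) = ⊥ := by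
      rw [eq_bot_iff]
      rintro x ⟨⟨hxP, -⟩, ⟨hxQ, -⟩⟩
      exact hdis.le_bot ⟨hxP, hxQ⟩
    rw [hbot, finrank_bot, add_zero] at hkey
    exact hkey

/-- The `⨆`-spelling of additivity: `finrank ↥((⨆_{r ∈ S} P r) ⊓ E) = Σ_{r ∈ S} finrank ↥(P r ⊓ E)`. [cite: Brown1982, III §5] -/
theorem finrank_biSup_inf_eigen_eq_sum (hE : ∀ x, x ∈ E ↔ ∀ i, T i x = χ i • x) {α : Type*} [DecidableEq α] (P : α → Submodule k M)
    (hTP : ∀ i r, ∀ x ∈ P r, T i x ∈ P r) [hfd : ∀ r, FiniteDimensional k (P r)] (S : Finset α) (hind : S.SupIndep P) :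
    finrank k ↥((⨆ r ∈ S, P r) ⊓ E) = ∑ r ∈ S, finrank k ↥(P r ⊓ E) := by
  rw [← Finset.sup_eq_iSup]
  exact finrank_finsetSup_inf_eigen_eq_sum hE P hTP S hind

end Eigen

/-! ## §5 The isotypic snake -/

section Snake

variable {k : Type*} [Field k] {A B C : Type*} [AddCommGroup A] [Module k A] [AddCommGroup B] [Module k B] [AddCommGroup C] [Module k C]
  {ι : Type*} {χ : ι → k} {TA : ι → A →ₗ[k] A} {TB : ι → B →ₗ[k] B} {TC : ι → C →ₗ[k] C}
  {EA : Submodule k A} {EB : Submodule k B} {EC : Submodule k C}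

/-- The eigen-row `E_A →f E_B →g E_C` of an exact `A →f B →g C` with `f` injective and `f, g` equivariant is exact in the middle (no averaging needed). [cite: BernsteinZelevinsky1976, §2.3] -/
theorem exact_restrict_eigen (hEA : ∀ x, x ∈ EA ↔ ∀ i, TA i x = χ i • x) (hEB : ∀ y, y ∈ EB ↔ ∀ i, TB i y = χ i • y)
    (f : A →ₗ[k] B) (g : B →ₗ[k] C) (hf : Injective f) (hfg : Exact f g) (hfT : ∀ i, f ∘ₗ TA i = TB i ∘ₗ f)
    (hfE : ∀ x ∈ EA, f x ∈ EB) (hgE : ∀ y ∈ EB, g y ∈ EC) : Exact (f.restrict hfE) (g.restrict hgE) := by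
  intro y
  constructor
  · intro hy
    have hy' : g (y : B) = 0 := by simpa [LinearMap.restrict_apply] using congrArg Subtype.val hy
    obtain ⟨x, hx⟩ := (hfg (y : B)).1 hy'
    have hxE : x ∈ EA := mem_eigen_of_apply_mem_eigen hEA hEB hf hfT (by rw [hx]; exact y.2)
    exact ⟨⟨x, hxE⟩, Subtype.ext (by simpa [LinearMap.restrict_apply] using hx)⟩
  · rintro ⟨x, rfl⟩
    exact Subtype.ext (by simp [LinearMap.restrict_apply, hfg.apply_apply_eq_zero])

/-- **THE ISOTYPIC SNAKE.**  `0 → A →f B →g C → 0` exact with commuting endomorphisms `a b c` (`f ∘ a = b ∘ f`, `g ∘ b = c ∘ g`), `b` injective, `C` finite-dimensional — as in ★ 47a′ — and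
commuting families `TA TB TC` intertwined by `f g` and commuting with `a b c`, with simultaneous eigenspaces `EA EB EC` for the scalars `χ`; if `g` maps `EB` ONTO `EC` (the one analytic
input: exactness of isotypic parts, e.g. for a compact group acting smoothly), then **`finrank (↥EA ⧸ range a|_EA) = finrank (↥EB ⧸ range b|_EB)`**.
[cite: BernsteinZelevinsky1976, §2.3] [cite: Casselman1995, §6.3] [cite: Brown1982, III §6] -/
theorem finrank_quotient_range_restrict_eq_of_exact (hEA : ∀ x, x ∈ EA ↔ ∀ i, TA i x = χ i • x) (hEB : ∀ y, y ∈ EB ↔ ∀ i, TB i y = χ i • y)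
    (f : A →ₗ[k] B) (g : B →ₗ[k] C) (hf : Injective f) (hfg : Exact f g)
    (a : A →ₗ[k] A) (b : B →ₗ[k] B) (c : C →ₗ[k] C) (hab : f ∘ₗ a = b ∘ₗ f) (hbc : g ∘ₗ b = c ∘ₗ g) (hb : Injective b)
    (hfT : ∀ i, f ∘ₗ TA i = TB i ∘ₗ f)
    (hfE : ∀ x ∈ EA, f x ∈ EB) (hgE : ∀ y ∈ EB, g y ∈ EC) (haE : ∀ x ∈ EA, a x ∈ EA) (hbE : ∀ y ∈ EB, b y ∈ EB) (hcE : ∀ z ∈ EC, c z ∈ EC)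
    (hsurj : ∀ z ∈ EC, ∃ y ∈ EB, g y = z) [FiniteDimensional k C] :
    finrank k (↥EA ⧸ LinearMap.range (a.restrict haE)) = finrank k (↥EB ⧸ LinearMap.range (b.restrict hbE)) := by
  haveI : FiniteDimensional k EC := FiniteDimensional.finiteDimensional_submodule EC
  refine finrank_quotient_range_eq_of_exact (f.restrict hfE) (g.restrict hgE) ?_ (exact_restrict_eigen hEA hEB f g hf hfg hfT hfE hgE) ?_
    (a.restrict haE) (b.restrict hbE) (c.restrict hcE) ?_ ?_ ?_
  · exact fun x y hxy => Subtype.ext (hf (by simpa [LinearMap.restrict_apply] using congrArg Subtype.val hxy))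
  · rintro ⟨z, hz⟩
    obtain ⟨y, hyE, hyz⟩ := hsurj z hz
    exact ⟨⟨y, hyE⟩, Subtype.ext (by simpa [LinearMap.restrict_apply] using hyz)⟩
  · ext x
    simpa [LinearMap.restrict_apply] using LinearMap.congr_fun hab (x : A)
  · ext y
    simpa [LinearMap.restrict_apply] using LinearMap.congr_fun hbc (y : B)
  · exact fun x y hxy => Subtype.ext (hb (by simpa [LinearMap.restrict_apply] using congrArg Subtype.val hxy))

end Snake

end LinearMap
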